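import Mathlib
import HarnessLib
import Summits.NavierStokesRegularity.NavierStokesRegularity.Theorems.CriticalFluxDoorDefs
import Summits.NavierStokesRegularity.NavierStokesRegularity.Theorems.CriticalFluxDoorLambdaDecay

/-!
# Door S21-C «CriticalFluxDoor» — flux-table entry 1 of F3: the windowed critical energy of a door-class slice VANISHES
# as `s → −∞` (`|Q(a_R, v s)| ≤ |B_{2R}|·|D|·K'·(−s)^{−3/2}`)

Door S21-C of nsreg-p1's local Type-I door family (`HOME/ns-regularity-ideate-p1/ROUND-20.md`; DESIGN-ONLY, route NOT born).
`Q(a,f) = critEnergy a f = ∫ a⟪f, Λf⟫` is the tree's `…CriticalFluxDoorDefs.critEnergy`.  For a door-class profile and the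
weights `a_R = bumpSq η R`:

* `abs_critEnergy_slice_le` — `|Q(a_R, v s)| ≤ |B_{2R}(0)|·|D|K'/((−s)√(−s))` for every `R > 0`, `s < 0` (decay `‖v‖ ≤ D/‖x‖`
  against the door-class `K'` of `…CriticalFluxDoorLambdaDecay.fracLapHalf_sliceDecay_of_class`);
* `tendsto_critEnergy_slice_atBot` — `Q(a_R, v s) → 0` as `s → −∞`: the boundary term of the F3 budget on `(−∞, t₀]`.

Proofs: nsreg-p1 g17 (`r20/LambdaDecay.lean` v5 §E5, farm rc 0), ported to the tree's `critEnergy` by nsreg-p6 g13.  Seat nsreg-p6 g13 (THEOREMS-ONLY door sequels, DIRECTOR-NS g8 #32 (2)/#36).  WHAT THIS IS NOT: not NS regularity (Clay A); not F3 (the budget itself); no route is opened.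
-/

noncomputable section

-- the summit and its single sub-problem share the name (CONVENTIONS §1), as in every Theorems file
set_option linter.dupNamespace false

namespace Summit.NavierStokesRegularity.NavierStokesRegularity.Theorems.CriticalFluxDoorCritEnergySlice

open MeasureTheory Metric Set Filter Topology Function
open Literature.Analysis Literature.Analysis.FluidPDE
open Summit.NavierStokesRegularity.NavierStokesRegularity.Theorems.ChiralWindowDoorDefs
open Summit.NavierStokesRegularity.NavierStokesRegularity.Theorems.CriticalFluxDoorDefs
open Summit.NavierStokesRegularity.NavierStokesRegularity.Theorems.CriticalFluxDoorLambdaDecay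

/-- **`|Q(a_R, v s)| ≤ |B_{2R}(0)|·|D|K'/((−s)√(−s))`** for a door-class profile, every `R > 0`, `s < 0` (no integrability
needed: the integrand is dominated by a constant on `B_{2R}` and vanishes off it). -/
theorem abs_critEnergy_slice_le {η : EuclideanSpace ℝ (Fin 3) → ℝ} (hη : IsAdmissibleBump η) {C D : ℝ} {v : ℝ → EuclideanSpace ℝ (Fin 3) → EuclideanSpace ℝ (Fin 3)}
    (hrate : HasTypeITimeDecay C v) (hdec : HasTypeIDecay D v) (hcont : ContinuousOn (uncurry v) (Iio (0 : ℝ) ×ˢ univ))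
    (hmild : ∀ s t : ℝ, s < t → t < 0 → ∀ x,
      v t x = UnboundedOperators.heatExtension (v s) (t - s) x - oseenDuhamel 1 s v v t x)
    (hdiv : ∀ t < 0, VectorCalculus.IsDivFree (v t)) :
    ∃ K' : ℝ, 0 ≤ K' ∧ ∀ R > (0 : ℝ), ∀ s < (0 : ℝ),
      |critEnergy (bumpSq η R) (v s)| ≤
        (volume : Measure (EuclideanSpace ℝ (Fin 3))).real (ball 0 (2 * R)) * (|D| * K') / ((-s) * Real.sqrt (-s)) := by
  obtain ⟨K', hK'⟩ := fracLapHalf_sliceDecay_of_class hrate hdec hcont hmild hdiv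
  have hK'0 : 0 ≤ K' := le_trans (by positivity) (hK' (-1) (by norm_num) 0)
  refine ⟨K', hK'0, fun R hR s hs => ?_⟩
  have hsq : 0 < Real.sqrt (-s) := Real.sqrt_pos.2 (neg_pos.2 hs)
  have hms : 0 < -s := neg_pos.2 hs
  set M : ℝ := |D| / Real.sqrt (-s) * (K' / (-s)) with hM
  have hM0 : 0 ≤ M := by positivity
  -- pointwise domination by the indicator of `B_{2R}`
  have hpt : ∀ x, ‖bumpSq η R x * inner ℝ (v s x) (fracLapHalf (v s) x)‖ ≤
      (ball (0 : EuclideanSpace ℝ (Fin 3)) (2 * R)).indicator (fun _ => M) x := by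
    intro x
    by_cases hx : x ∈ ball (0 : EuclideanSpace ℝ (Fin 3)) (2 * R)
    · rw [indicator_of_mem hx, Real.norm_eq_abs, abs_mul, abs_of_nonneg (bumpSq_nonneg η R x)]
      have h1 : bumpSq η R x ≤ 1 := bumpSq_le_one hη R x
      have h2 : |inner ℝ (v s x) (fracLapHalf (v s) x)| ≤ ‖v s x‖ * ‖fracLapHalf (v s) x‖ :=
        abs_real_inner_le_norm _ _
      have hv : ‖v s x‖ ≤ |D| / Real.sqrt (-s) := by
        calc ‖v s x‖ ≤ D / (‖x‖ + Real.sqrt (-s)) := hdec s hs x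
          _ ≤ |D| / (‖x‖ + Real.sqrt (-s)) := div_le_div_of_nonneg_right (le_abs_self D) (by positivity)
          _ ≤ |D| / Real.sqrt (-s) :=
              div_le_div_of_nonneg_left (abs_nonneg D) hsq (le_add_of_nonneg_left (norm_nonneg x))
      have hL : ‖fracLapHalf (v s) x‖ ≤ K' / (-s) := by
        rw [le_div_iff₀ hms]
        calc ‖fracLapHalf (v s) x‖ * -s = Real.sqrt (-s) ^ 2 * ‖fracLapHalf (v s) x‖ := by
              rw [Real.sq_sqrt hms.le]; ring
          _ ≤ (‖x‖ + Real.sqrt (-s)) ^ 2 * ‖fracLapHalf (v s) x‖ := by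
              gcongr; exact le_add_of_nonneg_left (norm_nonneg x)
          _ ≤ K' := hK' s hs x
      have h3 : ‖v s x‖ * ‖fracLapHalf (v s) x‖ ≤ M :=
        mul_le_mul hv hL (norm_nonneg _) (by positivity)
      calc bumpSq η R x * |inner ℝ (v s x) (fracLapHalf (v s) x)|
          ≤ 1 * (‖v s x‖ * ‖fracLapHalf (v s) x‖) :=
            mul_le_mul h1 h2 (abs_nonneg _) zero_le_one
        _ ≤ M := by rw [one_mul]; exact h3
    · rw [indicator_of_notMem hx]
      have hx' : 2 * R ≤ ‖x‖ := by rwa [mem_ball_zero_iff, not_lt] at hx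
      rw [bumpSq_eq_zero hη hR hx', zero_mul, norm_zero]
  have hint : Integrable ((ball (0 : EuclideanSpace ℝ (Fin 3)) (2 * R)).indicator fun _ => M) :=
    (integrable_indicator_iff measurableSet_ball).2 (integrableOn_const measure_ball_lt_top.ne)
  have h := norm_integral_le_of_norm_le hint (ae_of_all _ hpt)
  rw [integral_indicator_const M measurableSet_ball, smul_eq_mul, Real.norm_eq_abs] at h
  unfold critEnergy
  calc |∫ x, bumpSq η R x * inner ℝ (v s x) (fracLapHalf (v s) x)|
      ≤ (volume : Measure (EuclideanSpace ℝ (Fin 3))).real (ball 0 (2 * R)) * M := h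
    _ = (volume : Measure (EuclideanSpace ℝ (Fin 3))).real (ball 0 (2 * R)) * (|D| * K') / ((-s) * Real.sqrt (-s)) := by
        rw [hM]; field_simp

/-- **`Q(a_R, v s) → 0` as `s → −∞`** for a door-class profile and every `R > 0`. -/
theorem tendsto_critEnergy_slice_atBot {η : EuclideanSpace ℝ (Fin 3) → ℝ} (hη : IsAdmissibleBump η) {C D : ℝ} {v : ℝ → EuclideanSpace ℝ (Fin 3) → EuclideanSpace ℝ (Fin 3)}
    (hrate : HasTypeITimeDecay C v) (hdec : HasTypeIDecay D v) (hcont : ContinuousOn (uncurry v) (Iio (0 : ℝ) ×ˢ univ))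
    (hmild : ∀ s t : ℝ, s < t → t < 0 → ∀ x,
      v t x = UnboundedOperators.heatExtension (v s) (t - s) x - oseenDuhamel 1 s v v t x)
    (hdiv : ∀ t < 0, VectorCalculus.IsDivFree (v t)) {R : ℝ} (hR : 0 < R) :
    Tendsto (fun s => critEnergy (bumpSq η R) (v s)) atBot (𝓝 0) := by
  obtain ⟨K', hK'0, hK'⟩ := abs_critEnergy_slice_le hη hrate hdec hcont hmild hdiv
  set c : ℝ := (volume : Measure (EuclideanSpace ℝ (Fin 3))).real (ball 0 (2 * R)) * (|D| * K') with hc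
  -- the majorant `c/((−s)√(−s))` tends to `0`
  have hden : Tendsto (fun s : ℝ => (-s) * Real.sqrt (-s)) atBot atTop := by
    have h1 : Tendsto (fun s : ℝ => -s) atBot atTop := tendsto_neg_atBot_atTop
    have h2 : Tendsto (fun s : ℝ => Real.sqrt (-s)) atBot atTop :=
      Real.tendsto_sqrt_atTop.comp h1
    exact h1.atTop_mul_atTop₀ h2
  have hmaj : Tendsto (fun s : ℝ => c / ((-s) * Real.sqrt (-s))) atBot (𝓝 0) :=
    hden.const_div_atTop c
  refine squeeze_zero_norm' ?_ hmaj
  filter_upwards [eventually_lt_atBot (0 : ℝ)] with s hs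
  rw [Real.norm_eq_abs]
  exact hK' R hR s hs

end Summit.NavierStokesRegularity.NavierStokesRegularity.Theorems.CriticalFluxDoorCritEnergySlice

end
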